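import Mathlib
import HarnessLib
import Summits.NavierStokesRegularity.NavierStokesRegularity.Theorems.PoloidalWindowDoorLrcModEntireTwistingTHOscSimilarityObject

/-!
# Item `LrcModEntire` (stmt-NavierStokesRegularity-20428), skeleton twist_split v6, CLASS road to `stub_twistingTHGerm` —
# (h2-b, signed) the OBJECT TRANSFER `(t,z) → (τ,ξ)` for a SIGNED physical-variable plane-oscillation object

Cell ns-regularity-ideate, seat ns-k2-port-2 g4 (kernel-port lineage; `--supports stmt-NavierStokesRegularity-20428 --as helper`; signed twin of
`…TwistingTHOscSimilarityObject.simObject_of_planeObject_poly` (port-2 g3)).  INPUT (in `(t,z)`, `t < 0`): `U, S : ℝ → ℝ → ℝ` with `uncurry U`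
Fréchet-differentiable (`Ud t z`, time component continuous in `z`), `U(t,·) ∈ C²`, `S(t,·) ∈ C¹`; the SIGNED law
`U·(∂ₜU + ½∂_z(S·U) − ∂_zzU) ≤ 0` pointwise (no sign of `U` assumed — this is what the (BRANCH) object `(1−μ)(Θ⁺−Θ⁻)` of the LEAD's memo
OSC-LIOUVILLE-g13 §5septies satisfies on both signs of `1−μ`); the scale-invariant POLYNOMIAL size `√(−t)|U| ≤ C(1 + z²/(−t))^k`, `√(−t)|S| ≤ A`, and the
polynomial bounds `(−t)^{3/2}|∂ₜU|, (−t)|∂_zU|, (−t)^{3/2}|∂_zzU|, (−t)|∂_zS| ≤ K(1 + z²/(−t))^k`.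
OUTPUT (`simSignedObject_of_planeSignedObject`): for `Q := simQ U`, `Ŝ := simQ S` there is `Qt` with the hypothesis list of
`…TwistingTHOscSignedLiouville.eq_zero_of_ancient_signedSolution` — `Q(τ,·) ∈ C²`, `HasDerivAt` in `τ`, `Qt(τ,·)` continuous,
`|Q|, |Qt|, |Q_ξ|, |Q_ξξ|, |Ŝ_ξ| ≤ K′(1+ξ²)^{k+1}` (`K′ = 2K + C`), `Ŝ(τ,·) ∈ C¹`, `|Ŝ| ≤ A`, and the signed similarity law
`Q·(Qt + ½∂_ξ((ξ+Ŝ)Q) − Q_ξξ) ≤ 0` — because `sim_operator_eq` is an IDENTITY (`L̂Q = σ³·LU` at corresponding points), so `Q·L̂Q = σ⁴·(U·LU)`.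

WHAT THIS IS NOT: not a claim about Navier–Stokes regularity and not the stub — calculus/bookkeeping (bears_on LADDER-NS N0, item 20428 / crux 19708).
-/

noncomputable section

-- the summit and its single sub-problem share the name (CONVENTIONS §1), as in every Theorems file
set_option linter.dupNamespace false

namespace Summit.NavierStokesRegularity.NavierStokesRegularity.Theorems.PoloidalWindowDoorLrcModEntireTwistingTHOscSimilarityObjectSigned

open Set Filter Topology
open Summit.NavierStokesRegularity.NavierStokesRegularity.Theorems.PoloidalWindowDoorLrcModEntireTwistingTHOscSimilarityDefs
open Summit.NavierStokesRegularity.NavierStokesRegularity.Theorems.PoloidalWindowDoorLrcModEntireTwistingTHOscSimilarityTransform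
open Summit.NavierStokesRegularity.NavierStokesRegularity.Theorems.PoloidalWindowDoorLrcModEntireTwistingTHOscSimilarityObject

variable {U S : ℝ → ℝ → ℝ} {Ud : ℝ → ℝ → (ℝ × ℝ →L[ℝ] ℝ)} {A C K : ℝ} {k : ℕ}

/-- **THE SIGNED similarity law from the signed physical law**: with `Qt` the `τ`-derivative value of `hasDerivAt_simQ_time`,
`Q·(Qt + ½∂_ξ((ξ+Ŝ)Q) − ∂_ξ∂_ξQ) = σ⁴ · U·(∂ₜU + ½∂_z(S·U) − ∂_z∂_zU)` at corresponding points (`sim_operator_eq`), hence `≤ 0`. -/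
theorem sim_signed_of_signed
    (hUF : ∀ t < 0, ∀ z, HasFDerivAt (Function.uncurry U) (Ud t z) (t, z))
    (hU2 : ∀ t < 0, Differentiable ℝ (deriv (U t))) (hS : ∀ t < 0, Differentiable ℝ (S t))
    (hsgn : ∀ t < 0, ∀ z, U t z * (Ud t z (1, 0) + (1 / 2 : ℝ) * deriv (fun z => S t z * U t z) z - deriv (deriv (U t)) z) ≤ 0)
    (τ ξ : ℝ) :
    simQ U τ ξ * ((sig τ ^ 3 * Ud (tim τ) (ξ * sig τ) (1, 0) - (1 / 2 : ℝ) * sig τ * U (tim τ) (ξ * sig τ)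
        - (1 / 2 : ℝ) * ξ * sig τ ^ 2 * Ud (tim τ) (ξ * sig τ) (0, 1))
      + (1 / 2 : ℝ) * deriv (fun ξ' => (ξ' + simQ S τ ξ') * simQ U τ ξ') ξ - deriv (deriv (simQ U τ)) ξ) ≤ 0 := by
  have ht := tim_neg τ
  have hU : Differentiable ℝ (U (tim τ)) := fun z => (deriv_slice_eq (hUF _ ht z)).differentiableAt
  have h := sim_operator_eq (S := S) (ξ := ξ) (hUF _ ht (ξ * sig τ)) hU (hU2 _ ht) (hS _ ht (ξ * sig τ))
  rw [h]
  unfold simQ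
  have hs4 : 0 < sig τ * sig τ ^ 3 := by positivity [sig_pos τ]
  have hle := hsgn _ ht (ξ * sig τ)
  have e : sig τ * U (tim τ) (ξ * sig τ) *
        (sig τ ^ 3 * (Ud (tim τ) (ξ * sig τ) (1, 0) + (1 / 2 : ℝ) * deriv (fun z => S (tim τ) z * U (tim τ) z) (ξ * sig τ)
          - deriv (deriv (U (tim τ))) (ξ * sig τ))) =
      (sig τ * sig τ ^ 3) * (U (tim τ) (ξ * sig τ) *
        (Ud (tim τ) (ξ * sig τ) (1, 0) + (1 / 2 : ℝ) * deriv (fun z => S (tim τ) z * U (tim τ) z) (ξ * sig τ)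
          - deriv (deriv (U (tim τ))) (ξ * sig τ))) := by ring
  rw [e]
  exact mul_nonpos_of_nonneg_of_nonpos hs4.le hle

/-- **(h2-b, SIGNED) THE OBJECT TRANSFER.**  See the module docstring for INPUT/OUTPUT.  The produced time derivative is
`Qt τ ξ = σ³·∂ₜU − ½σ·U − ½ξσ²·∂_zU` at `(t,z) = (tim τ, ξ·sig τ)`. -/
theorem simSignedObject_of_planeSignedObject
    (hUF : ∀ t < 0, ∀ z, HasFDerivAt (Function.uncurry U) (Ud t z) (t, z))
    (hUtc : ∀ t < 0, Continuous fun z => Ud t z (1, 0))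
    (hU2 : ∀ t < 0, ContDiff ℝ 2 (U t)) (hS1 : ∀ t < 0, ContDiff ℝ 1 (S t))
    (hsgn : ∀ t < 0, ∀ z, U t z * (Ud t z (1, 0) + (1 / 2 : ℝ) * deriv (fun z => S t z * U t z) z - deriv (deriv (U t)) z) ≤ 0)
    (hUb : ∀ t < 0, ∀ z, Real.sqrt (-t) * |U t z| ≤ C * (1 + z ^ 2 / (-t)) ^ k)
    (hSA : ∀ t < 0, ∀ z, Real.sqrt (-t) * |S t z| ≤ A)
    (hUt : ∀ t < 0, ∀ z, Real.sqrt (-t) * (-t) * |Ud t z (1, 0)| ≤ K * (1 + z ^ 2 / (-t)) ^ k)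
    (hUz : ∀ t < 0, ∀ z, (-t) * |deriv (U t) z| ≤ K * (1 + z ^ 2 / (-t)) ^ k)
    (hUzz : ∀ t < 0, ∀ z, Real.sqrt (-t) * (-t) * |deriv (deriv (U t)) z| ≤ K * (1 + z ^ 2 / (-t)) ^ k)
    (hSz : ∀ t < 0, ∀ z, (-t) * |deriv (S t) z| ≤ K * (1 + z ^ 2 / (-t)) ^ k) :
    ∃ Qt : ℝ → ℝ → ℝ,
      (∀ τ, ContDiff ℝ 2 (simQ U τ)) ∧ (∀ τ ξ, HasDerivAt (fun τ' => simQ U τ' ξ) (Qt τ ξ) τ) ∧ (∀ τ, Continuous (Qt τ)) ∧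
      (∀ τ ξ, |simQ U τ ξ| ≤ (2 * K + C) * (1 + ξ ^ 2) ^ (k + 1)) ∧
      (∀ τ ξ, |Qt τ ξ| ≤ (2 * K + C) * (1 + ξ ^ 2) ^ (k + 1)) ∧
      (∀ τ ξ, |deriv (simQ U τ) ξ| ≤ (2 * K + C) * (1 + ξ ^ 2) ^ (k + 1)) ∧
      (∀ τ ξ, |deriv (deriv (simQ U τ)) ξ| ≤ (2 * K + C) * (1 + ξ ^ 2) ^ (k + 1)) ∧
      (∀ τ, ContDiff ℝ 1 (simQ S τ)) ∧ (∀ τ ξ, |simQ S τ ξ| ≤ A) ∧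
      (∀ τ ξ, |deriv (simQ S τ) ξ| ≤ (2 * K + C) * (1 + ξ ^ 2) ^ (k + 1)) ∧
      (∀ τ ξ, simQ U τ ξ * (Qt τ ξ + (1 / 2 : ℝ) * deriv (fun ξ' => (ξ' + simQ S τ ξ') * simQ U τ ξ') ξ
        - deriv (deriv (simQ U τ)) ξ) ≤ 0) := by
  -- the time derivative, with `L(0,1)` written as the slice derivative
  set Qt : ℝ → ℝ → ℝ := fun τ ξ => sig τ ^ 3 * Ud (tim τ) (ξ * sig τ) (1, 0)
    - (1 / 2 : ℝ) * sig τ * U (tim τ) (ξ * sig τ) - (1 / 2 : ℝ) * ξ * sig τ ^ 2 * deriv (U (tim τ)) (ξ * sig τ) with hQt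
  -- constants are non-negative (from the bounds at one point)
  have hK0 : 0 ≤ K := by
    have h := hUz (-1) (by norm_num) 0
    have h1 : 0 ≤ (-(-1:ℝ)) * |deriv (U (-1)) 0| := by positivity
    have h2 : (0:ℝ) < (1 + (0:ℝ) ^ 2 / (-(-1:ℝ))) ^ k := by positivity
    nlinarith
  have hc0 : 0 ≤ C := by
    have h := hUb (-1) (by norm_num) 0
    have h1 : 0 ≤ Real.sqrt (-(-1:ℝ)) * |U (-1) 0| := by positivity
    have h2 : (1 + (0:ℝ) ^ 2 / (-(-1:ℝ))) ^ k = 1 := by simp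
    rw [h2, mul_one] at h
    linarith
  -- regularity facts at time `tim τ`
  have hUd : ∀ τ, Differentiable ℝ (U (tim τ)) := fun τ => (hU2 _ (tim_neg τ)).differentiable (by norm_num)
  have hU1 : ∀ τ, ContDiff ℝ 1 (deriv (U (tim τ))) := fun τ => by
    have h2 : ContDiff ℝ (1 + 1) (U (tim τ)) := by rw [one_add_one_eq_two]; exact hU2 _ (tim_neg τ)
    exact h2.deriv'
  have hU2d : ∀ τ, Differentiable ℝ (deriv (U (tim τ))) := fun τ => (hU1 τ).differentiable (by norm_num)
  have hSd : ∀ τ, Differentiable ℝ (S (tim τ)) := fun τ => (hS1 _ (tim_neg τ)).differentiable (by norm_num)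
  have hslice : ∀ τ ξ, Ud (tim τ) (ξ * sig τ) (0, 1) = deriv (U (tim τ)) (ξ * sig τ) :=
    fun τ ξ => ((deriv_slice_eq (hUF _ (tim_neg τ) (ξ * sig τ))).deriv).symm
  have hlin : ∀ τ, ContDiff ℝ 2 (fun ξ : ℝ => ξ * sig τ) := fun τ => contDiff_id.mul contDiff_const
  refine ⟨Qt, ?_, ?_, ?_, ?_, ?_, ?_, ?_, ?_, ?_, ?_, ?_⟩
  · -- `Q(τ,·) ∈ C²`
    intro τ
    show ContDiff ℝ 2 (fun ξ => sig τ * U (tim τ) (ξ * sig τ))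
    exact contDiff_const.mul ((hU2 _ (tim_neg τ)).comp (hlin τ))
  · -- time derivative
    intro τ ξ
    have h := hasDerivAt_simQ_time (hUF _ (tim_neg τ) (ξ * sig τ))
    rw [hslice] at h
    simpa [hQt] using h
  · -- continuity of `Qt(τ,·)`
    intro τ
    have h1 : Continuous fun ξ : ℝ => Ud (tim τ) (ξ * sig τ) (1, 0) :=
      (hUtc _ (tim_neg τ)).comp (continuous_id.mul continuous_const)
    have h2 : Continuous fun ξ : ℝ => U (tim τ) (ξ * sig τ) := (hUd τ).continuous.comp (continuous_id.mul continuous_const)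
    have h3 : Continuous fun ξ : ℝ => deriv (U (tim τ)) (ξ * sig τ) :=
      (hU2d τ).continuous.comp (continuous_id.mul continuous_const)
    simp only [hQt]
    exact ((continuous_const.mul h1).sub (continuous_const.mul h2)).sub
      (((continuous_const.mul continuous_id).mul continuous_const).mul h3)
  · -- `|Q| ≤ K′(1+ξ²)^{k+1}`
    intro τ ξ
    have h := hUb _ (tim_neg τ) (ξ * sig τ)
    rw [sqrt_neg_tim, sim_ratio] at h
    have hPk : (1 + ξ ^ 2) ^ k ≤ (1 + ξ ^ 2) ^ (k + 1) := pow_le_pow_right₀ (by nlinarith [sq_nonneg ξ]) (Nat.le_succ k)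
    show |sig τ * U (tim τ) (ξ * sig τ)| ≤ _
    rw [abs_mul, abs_of_pos (sig_pos τ)]
    nlinarith [mul_nonneg hc0 (sub_nonneg.2 hPk), mul_nonneg hK0 (pow_nonneg (show (0:ℝ) ≤ 1 + ξ ^ 2 by positivity) (k + 1))]
  · -- `|Qt| ≤ K′(1+ξ²)^{k+1}`
    intro τ ξ
    have ht := tim_neg τ
    have hσ := sig_pos τ
    have hP : (1 + (ξ * sig τ) ^ 2 / (-tim τ)) = 1 + ξ ^ 2 := sim_ratio τ ξ
    have b1 : sig τ ^ 3 * |Ud (tim τ) (ξ * sig τ) (1, 0)| ≤ K * (1 + ξ ^ 2) ^ k := by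
      have h := hUt _ ht (ξ * sig τ)
      rw [sqrt_neg_tim, hP, ← sig_sq] at h
      calc sig τ ^ 3 * |Ud (tim τ) (ξ * sig τ) (1, 0)| = sig τ * sig τ ^ 2 * |Ud (tim τ) (ξ * sig τ) (1, 0)| := by ring
        _ ≤ K * (1 + ξ ^ 2) ^ k := h
    have b2 : sig τ * |U (tim τ) (ξ * sig τ)| ≤ C * (1 + ξ ^ 2) ^ k := by
      have h := hUb _ ht (ξ * sig τ); rwa [sqrt_neg_tim, hP] at h
    have b3 : sig τ ^ 2 * |deriv (U (tim τ)) (ξ * sig τ)| ≤ K * (1 + ξ ^ 2) ^ k := by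
      have h := hUz _ ht (ξ * sig τ)
      rwa [hP, ← sig_sq] at h
    have hP1 : 1 ≤ (1 + ξ ^ 2) ^ k := one_le_pow₀ (by nlinarith [sq_nonneg ξ])
    have hPk : (1 + ξ ^ 2) ^ k ≤ (1 + ξ ^ 2) ^ (k + 1) := pow_le_pow_right₀ (by nlinarith [sq_nonneg ξ]) (Nat.le_succ k)
    have hξ : |ξ| * (1 + ξ ^ 2) ^ k ≤ (1 + ξ ^ 2) ^ (k + 1) := by
      have hle : |ξ| ≤ 1 + ξ ^ 2 := by
        rcases le_or_gt |ξ| 1 with h | h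
        · nlinarith [sq_nonneg ξ]
        · have : |ξ| ≤ ξ ^ 2 := by rw [← sq_abs]; nlinarith
          linarith
      calc |ξ| * (1 + ξ ^ 2) ^ k ≤ (1 + ξ ^ 2) * (1 + ξ ^ 2) ^ k :=
            mul_le_mul_of_nonneg_right hle (pow_nonneg (show (0:ℝ) ≤ 1 + ξ ^ 2 by positivity) k)
        _ = (1 + ξ ^ 2) ^ (k + 1) := by ring
    have t1 : |sig τ ^ 3 * Ud (tim τ) (ξ * sig τ) (1, 0)| ≤ K * (1 + ξ ^ 2) ^ k := by
      rw [abs_mul, abs_of_pos (pow_pos hσ 3)]; exact b1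
    have t2 : |(1 / 2 : ℝ) * sig τ * U (tim τ) (ξ * sig τ)| ≤ C * (1 + ξ ^ 2) ^ k / 2 := by
      rw [mul_assoc, abs_mul, abs_of_pos (by norm_num : (0:ℝ) < 1 / 2), abs_mul, abs_of_pos hσ]; linarith
    have t3 : |(1 / 2 : ℝ) * ξ * sig τ ^ 2 * deriv (U (tim τ)) (ξ * sig τ)| ≤ (1 / 2 : ℝ) * |ξ| * (K * (1 + ξ ^ 2) ^ k) := by
      have e : (1 / 2 : ℝ) * ξ * sig τ ^ 2 * deriv (U (tim τ)) (ξ * sig τ) =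
          ((1 / 2 : ℝ) * ξ) * (sig τ ^ 2 * deriv (U (tim τ)) (ξ * sig τ)) := by ring
      rw [e, abs_mul, abs_mul, abs_of_pos (by norm_num : (0:ℝ) < 1 / 2), abs_mul, abs_of_pos (pow_pos hσ 2)]
      exact mul_le_mul_of_nonneg_left b3 (by positivity)
    have tri : |Qt τ ξ| ≤ |sig τ ^ 3 * Ud (tim τ) (ξ * sig τ) (1, 0)| + |(1 / 2 : ℝ) * sig τ * U (tim τ) (ξ * sig τ)|
        + |(1 / 2 : ℝ) * ξ * sig τ ^ 2 * deriv (U (tim τ)) (ξ * sig τ)| := by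
      simp only [hQt]
      exact (abs_sub _ _).trans (add_le_add (abs_sub _ _) le_rfl)
    calc |Qt τ ξ| ≤ _ := tri
      _ ≤ K * (1 + ξ ^ 2) ^ k + C * (1 + ξ ^ 2) ^ k / 2 + (1 / 2 : ℝ) * |ξ| * (K * (1 + ξ ^ 2) ^ k) := by linarith
      _ ≤ (2 * K + C) * (1 + ξ ^ 2) ^ (k + 1) := by
          nlinarith [mul_nonneg hK0 (sub_nonneg.2 hPk), mul_nonneg hc0 (sub_nonneg.2 hPk),
            mul_nonneg hc0 (pow_nonneg (show (0:ℝ) ≤ 1 + ξ ^ 2 by positivity) k),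
            mul_nonneg hK0 (sub_nonneg.2 hξ), mul_nonneg hK0 (pow_nonneg (show (0:ℝ) ≤ 1 + ξ ^ 2 by positivity) (k + 1)),
            abs_nonneg ξ, mul_nonneg (abs_nonneg ξ) (pow_nonneg (show (0:ℝ) ≤ 1 + ξ ^ 2 by positivity) k)]
  · -- `|Q_ξ| ≤ K′(1+ξ²)^{k+1}`
    intro τ ξ
    have ht := tim_neg τ
    rw [deriv_simQ_xi (hUd τ)]
    have h := hUz _ ht (ξ * sig τ)
    rw [sim_ratio, ← sig_sq] at h
    have hPk : (1 + ξ ^ 2) ^ k ≤ (1 + ξ ^ 2) ^ (k + 1) := pow_le_pow_right₀ (by nlinarith [sq_nonneg ξ]) (Nat.le_succ k)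
    rw [abs_mul, abs_of_pos (pow_pos (sig_pos τ) 2)]
    nlinarith [mul_nonneg hK0 (sub_nonneg.2 hPk), mul_nonneg hc0 (pow_nonneg (show (0:ℝ) ≤ 1 + ξ ^ 2 by positivity) (k + 1)),
      mul_nonneg hK0 (pow_nonneg (show (0:ℝ) ≤ 1 + ξ ^ 2 by positivity) (k + 1))]
  · -- `|Q_ξξ| ≤ K′(1+ξ²)^{k+1}`
    intro τ ξ
    have ht := tim_neg τ
    rw [deriv_deriv_simQ_xi (hUd τ) (hU2d τ)]
    have h := hUzz _ ht (ξ * sig τ)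
    rw [sqrt_neg_tim, sim_ratio, ← sig_sq] at h
    have hPk : (1 + ξ ^ 2) ^ k ≤ (1 + ξ ^ 2) ^ (k + 1) := pow_le_pow_right₀ (by nlinarith [sq_nonneg ξ]) (Nat.le_succ k)
    rw [abs_mul, abs_of_pos (pow_pos (sig_pos τ) 3)]
    have e : sig τ ^ 3 = sig τ * sig τ ^ 2 := by ring
    rw [e]
    nlinarith [mul_nonneg hK0 (sub_nonneg.2 hPk), mul_nonneg hc0 (pow_nonneg (show (0:ℝ) ≤ 1 + ξ ^ 2 by positivity) (k + 1)),
      mul_nonneg hK0 (pow_nonneg (show (0:ℝ) ≤ 1 + ξ ^ 2 by positivity) (k + 1))]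
  · -- `Ŝ(τ,·) ∈ C¹`
    intro τ
    show ContDiff ℝ 1 (fun ξ => sig τ * S (tim τ) (ξ * sig τ))
    exact contDiff_const.mul ((hS1 _ (tim_neg τ)).comp ((hlin τ).of_le (by norm_num)))
  · -- `|Ŝ| ≤ A`
    intro τ ξ
    have h := hSA _ (tim_neg τ) (ξ * sig τ)
    rw [sqrt_neg_tim] at h
    show |sig τ * S (tim τ) (ξ * sig τ)| ≤ A
    rwa [abs_mul, abs_of_pos (sig_pos τ)]
  · -- `|Ŝ_ξ| ≤ K′(1+ξ²)^{k+1}`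
    intro τ ξ
    have ht := tim_neg τ
    rw [deriv_simQ_xi (hSd τ)]
    have h := hSz _ ht (ξ * sig τ)
    rw [sim_ratio, ← sig_sq] at h
    have hPk : (1 + ξ ^ 2) ^ k ≤ (1 + ξ ^ 2) ^ (k + 1) := pow_le_pow_right₀ (by nlinarith [sq_nonneg ξ]) (Nat.le_succ k)
    rw [abs_mul, abs_of_pos (pow_pos (sig_pos τ) 2)]
    nlinarith [mul_nonneg hK0 (sub_nonneg.2 hPk), mul_nonneg hc0 (pow_nonneg (show (0:ℝ) ≤ 1 + ξ ^ 2 by positivity) (k + 1)),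
      mul_nonneg hK0 (pow_nonneg (show (0:ℝ) ≤ 1 + ξ ^ 2 by positivity) (k + 1))]
  · -- the signed similarity law
    intro τ ξ
    have hU2all : ∀ t < 0, Differentiable ℝ (deriv (U t)) := fun t ht => by
      have h2 : ContDiff ℝ (1 + 1) (U t) := by rw [one_add_one_eq_two]; exact hU2 t ht
      exact h2.deriv'.differentiable (by norm_num)
    have hSall : ∀ t < 0, Differentiable ℝ (S t) := fun t ht => (hS1 t ht).differentiable (by norm_num)
    have h := sim_signed_of_signed (S := S) hUF hU2all hSall hsgn τ ξ
    rw [hslice] at h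
    simpa [hQt] using h

end Summit.NavierStokesRegularity.NavierStokesRegularity.Theorems.PoloidalWindowDoorLrcModEntireTwistingTHOscSimilarityObjectSigned
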